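import Literature.AlgebraicTopology.SingularHomology.CellAttachmentHomology
import Literature.AlgebraicTopology.SingularHomology.ClosedBallSphereHomology
import Literature.AlgebraicTopology.SingularHomology.UniverseTransport
import HarnessLib

/-!
# The relative homology of an embedded closed cell is concentrated in its dimension

For a closed `k`-cell `Φ : Dᵏ → X` attached to a closed subspace `Y` of a Hausdorff space `X`
(`Literature.AlgebraicTopology.SingularHomology.IsAttachedCell Y Φ`, `CellAttachmentHomology.lean`),
the embedded pair `(D', S') = (Φ(Dᵏ), Φ(∂Dᵏ)) = (Φ(Dᵏ), Φ(Dᵏ) ∩ Y)` has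
**`Hⱼ(D', S'; M) = 0` for `j ≠ k`**, and hence so has `(Y ∪ D', Y)` — Hatcher's Example 2.17
(*Algebraic Topology* (2002), p. 118: *"`Hᵢ(Dⁿ, ∂Dⁿ) ≅ ℤ` for `i = n` and `0` otherwise"*) and
Lemma 2.34 (a) for one cell, and the vanishing half of Milnor's Cor. 3.15 (*Lectures on the
h-cobordism theorem* (1965), PDF p. 19: *"`H⁎(W, V)` is … zero otherwise"*).

The space `X` may live in any universe while the model pair `(Dᵏ, ∂Dᵏ)` lives in `Type`, so the
computation of `ClosedBallSphereHomology.lean` cannot be moved along the homeomorphism of pairs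
`(Dᵏ, ∂Dᵏ) ≅ (D', S')` by an isomorphism of homology groups; instead the (formal) argument of
Example 2.17 is rerun on `(D', S')`: `D'` is contractible, `S'` is homeomorphic to `Sᵏ⁻¹`, whose
homology *vanishing* is transported across universes by the tree's
`Literature.AlgebraicTopology.SingularHomology.csingularHomology.isZero_of_homeomorph`
(`UniverseTransport.lean`), and `S'` is nonempty (`k ≥ 1`), path connected (`k ≥ 2`) or empty
(`k = 0`).  (The remaining group `Hₖ(D', S') ≅ M` would need a universe-changing comparison
isomorphism and is not treated here.)

## Main results

* `Literature.AlgebraicTopology.SingularHomology.singularHomology.isZero_of_homeomorph`: vanishing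
  of Mathlib-model singular homology is invariant under homeomorphisms across universes;
* `Literature.AlgebraicTopology.SingularHomology.IsAttachedCell.isZero_relativeSingularHomology_range`:
  `Hⱼ(D', S') = 0` for `j ≠ k`;
* `Literature.AlgebraicTopology.SingularHomology.IsAttachedCell.isZero_relativeSingularHomology_union`:
  `Hⱼ(Y ∪ D', Y) = 0` for `j ≠ k`.

## References

* A. Hatcher, *Algebraic Topology*, CUP 2002, §2.1, Example 2.17 (p. 118), Cor. 2.14,
  Lemma 2.34 (a). [HatcherAT2002]
* J. Milnor, *Lectures on the h-cobordism theorem*, Princeton 1965, Cor. 3.15 (PDF p. 19).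
  [MilnorHCobordism1965]
-/

noncomputable section

open CategoryTheory Limits Set Metric Function Topology

universe u v w

namespace Literature.AlgebraicTopology.SingularHomology

variable (R : Type v) [CommRing R] (M : Type v) [AddCommGroup M] [Module R M]

/-! ### Vanishing across universes, Mathlib model -/

/-- **Vanishing of singular homology is invariant under homeomorphisms across universes**
(Mathlib's model; from the concrete-model statement
`Literature.AlgebraicTopology.SingularHomology.csingularHomology.isZero_of_homeomorph` and the
comparison isomorphisms `csingularHomology.compIso`). [folklore] -/
theorem singularHomology.isZero_of_homeomorph {X : Type u} {Y : Type w} [TopologicalSpace X]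
    [TopologicalSpace Y] (e : X ≃ₜ Y) {n : ℕ} (h : IsZero (singularHomology R M X n)) :
    IsZero (singularHomology R M Y n) :=
  (csingularHomology.isZero_of_homeomorph R M e
    (h.of_iso (csingularHomology.compIso R M X n))).of_iso (csingularHomology.compIso R M Y n).symm

/-! ### The embedded pair `(D', S')` -/

/-- Local notation: the model space `ℝⁿ`. -/
local notation "𝔼 " n:arg => EuclideanSpace ℝ (Fin n)

/-- Local notation: the closed unit ball `Dⁿ ⊆ ℝⁿ`, as a set. -/
local notation "𝔹 " n:arg => Metric.closedBall (0 : EuclideanSpace ℝ (Fin n)) 1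

namespace IsAttachedCell

variable {X : Type u} [TopologicalSpace X] [T2Space X] {Y : Set X} {k : ℕ} {Φ : C(↥(𝔹 k), X)}

/-- The embedded disc `D'` is contractible. [folklore] -/
theorem contractibleSpace_range (h : IsAttachedCell Y Φ) : ContractibleSpace ↥(range Φ) :=
  haveI := contractibleSpace_closedBall k
  h.discHomeomorph.symm.contractibleSpace

/-- The embedded disc `D'` is path connected. [folklore] -/
theorem pathConnectedSpace_range (h : IsAttachedCell Y Φ) : PathConnectedSpace ↥(range Φ) := by
  haveI := pathConnectedSpace_closedBall k
  refine pathConnectedSpace_iff_univ.mpr ?_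
  have hu : (univ : Set ↥(range Φ)) = h.discHomeomorph '' univ := by
    rw [image_univ, h.discHomeomorph.surjective.range_eq]
  rw [hu]
  exact isPathConnected_univ.image h.discHomeomorph.continuous

/-- **The embedded sphere `S' = D' ∩ Y` is homeomorphic to `Sᵏ⁻¹`** (via `Dᵏ ≃ D'`), a
homeomorphism between spaces in different universes. [folklore] -/
def sphereHomeomorph (h : IsAttachedCell Y Φ) :
    ↥(sphere (0 : 𝔼 k) 1) ≃ₜ ↥(Subtype.val ⁻¹' Y : Set ↥(range Φ)) :=
  (boundarySphereHomeomorph k).symm.trans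
    ((h.discHomeomorph.image (Subtype.val ⁻¹' sphere (0 : 𝔼 k) 1)).trans
      (Homeomorph.setCongr h.image_preimage_sphere))

/-- `Hᵢ(S'; M) = 0` for `i ≠ 0` and `i + 1 ≠ k` (`S' ≅ Sᵏ⁻¹`, Hatcher Cor. 2.14, transported across
universes). [cite: HatcherAT2002, Cor. 2.14] -/
theorem isZero_singularHomology_sphere' (h : IsAttachedCell Y Φ) {i : ℕ} (hi : i ≠ 0)
    (hik : i + 1 ≠ k) : IsZero (singularHomology R M ↥(Subtype.val ⁻¹' Y : Set ↥(range Φ)) i) := by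
  cases k with
  | zero =>
    -- `S⁻¹ = ∅`
    haveI : IsEmpty ↥(Subtype.val ⁻¹' Y : Set ↥(range Φ)) :=
      ⟨fun z => (isEmpty_boundarySphere_zero).false
        ⟨h.discHomeomorph.symm z.1, by
          change ((h.discHomeomorph.symm z.1 : ↥(𝔹 0)) : 𝔼 0) ∈ sphere (0 : 𝔼 0) 1
          rw [mem_sphere_zero_iff_norm, ← h.mem_iff, h.apply_discHomeomorph_symm]
          exact z.2⟩⟩
    exact isZero_singularHomology_of_subsingleton R M hi
  | succ m =>
    exact singularHomology.isZero_of_homeomorph R M h.sphereHomeomorph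
      (isZero_singularHomology_sphere_holds R M (n := m) (k := i) hi (by omega))

omit [T2Space X] in
/-- `S'` is nonempty for `k ≥ 1`. [folklore] -/
theorem preimage_nonempty (h : IsAttachedCell Y Φ) (hk : k ≠ 0) :
    (Subtype.val ⁻¹' Y : Set ↥(range Φ)).Nonempty := by
  obtain ⟨m, rfl⟩ : ∃ m, k = m + 1 := ⟨k - 1, by omega⟩
  obtain ⟨x, hx⟩ := boundarySphere_nonempty m
  exact ⟨⟨Φ x, mem_range_self x⟩, (h.mem_iff x).mpr (mem_sphere_zero_iff_norm.mp hx)⟩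

/-- `S'` is path connected for `k ≥ 2`. [folklore] -/
theorem pathConnectedSpace_preimage (h : IsAttachedCell Y Φ) (hk : 2 ≤ k) :
    PathConnectedSpace ↥(Subtype.val ⁻¹' Y : Set ↥(range Φ)) := by
  obtain ⟨m, rfl⟩ : ∃ m, k = m + 1 + 1 := ⟨k - 2, by omega⟩
  haveI := pathConnectedSpace_boundarySphere m
  haveI : PathConnectedSpace ↥(sphere (0 : 𝔼 (m + 1 + 1)) 1) := by
    refine pathConnectedSpace_iff_univ.mpr ?_
    rw [← (boundarySphereHomeomorph (m + 1 + 1)).surjective.range_eq, ← image_univ]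
    exact isPathConnected_univ.image (boundarySphereHomeomorph (m + 1 + 1)).continuous
  refine pathConnectedSpace_iff_univ.mpr ?_
  have hu : (univ : Set ↥(Subtype.val ⁻¹' Y : Set ↥(range Φ))) = h.sphereHomeomorph '' univ := by
    rw [image_univ, h.sphereHomeomorph.surjective.range_eq]
  rw [hu]
  exact isPathConnected_univ.image h.sphereHomeomorph.continuous

/-- **`Hⱼ(D', S'; M) = 0` for `j ≠ k`** for the embedded closed `k`-cell `(D', S') = (Φ(Dᵏ),
Φ(Dᵏ) ∩ Y)` (Hatcher 2002, Example 2.17, rerun on the embedded pair: `D'` contractible, `S'`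
a `(k-1)`-sphere; Milnor 1965, Cor. 3.15, vanishing half).
[cite: HatcherAT2002, Example 2.17 (p. 118); MilnorHCobordism1965, Cor. 3.15 (PDF p. 19)] -/
theorem isZero_relativeSingularHomology_range (h : IsAttachedCell Y Φ) {j : ℕ} (hj : j ≠ k) :
    IsZero (relativeSingularHomology R M ↥(range Φ) (Subtype.val ⁻¹' Y) j) := by
  haveI := h.contractibleSpace_range
  haveI := h.pathConnectedSpace_range
  rcases j with _ | _ | i
  · -- `j = 0`, `k ≥ 1`: `D'` path connected, `S'` nonempty
    exact isZero_relativeSingularHomology_zero_of_pathConnectedSpace R M _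
      (h.preimage_nonempty (Ne.symm hj))
  · -- `j = 1`
    rcases Nat.lt_or_ge k 2 with hk | hk
    · -- `k = 0`: `S' = ∅`, `H₁(D', ∅) = H₁(D') = 0`
      have hk0 : k = 0 := by omega
      subst hk0
      haveI : IsEmpty ↥(Subtype.val ⁻¹' Y : Set ↥(range Φ)) :=
        ⟨fun z => (isEmpty_boundarySphere_zero).false
          ⟨h.discHomeomorph.symm z.1, by
            change ((h.discHomeomorph.symm z.1 : ↥(𝔹 0)) : 𝔼 0) ∈ sphere (0 : 𝔼 0) 1
            rw [mem_sphere_zero_iff_norm, ← h.mem_iff, h.apply_discHomeomorph_symm]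
            exact z.2⟩⟩
      haveI := relativeSingularHomology.isIso_ofAbsolute_of_isEmpty R M (X := ↥(range Φ))
        (Subtype.val ⁻¹' Y) 1
      exact (isZero_singularHomology_of_contractibleSpace R M one_ne_zero).of_iso
        (asIso (relativeSingularHomology.ofAbsolute R M ↥(range Φ) (Subtype.val ⁻¹' Y) 1)).symm
    · -- `k ≥ 2`: `S'` path connected
      haveI := h.pathConnectedSpace_preimage hk
      exact isZero_relativeSingularHomology_one_of_pathConnectedSpace R M _
        (isZero_singularHomology_of_contractibleSpace R M one_ne_zero)
  · -- `j = i + 2`: `Hᵢ₊₂(D') = 0` and `Hᵢ₊₁(S') = 0`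
    refine (relativeSingularHomology.exact_ofAbsolute_δ R M (X := ↥(range Φ))
      (Subtype.val ⁻¹' Y) (i + 1)).isZero_of_both_zeros
      ((isZero_singularHomology_of_contractibleSpace R M (by omega)).eq_of_src _ _)
      (IsZero.eq_of_tgt ?_ _ _)
    exact h.isZero_singularHomology_sphere' R M (i := i + 1) (by omega) (by omega)

/-- **`Hⱼ(Y ∪ D', Y; M) = 0` for `j ≠ k`** (Hatcher 2002, Lemma 2.34 (a) for one cell; Milnor 1965,
Cor. 3.15 with Thm. 3.14, vanishing half), by `isIso_map_inclusion`.
[cite: HatcherAT2002, Lemma 2.34 (a); MilnorHCobordism1965, Cor. 3.15 (PDF p. 19)] -/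
theorem isZero_relativeSingularHomology_union (h : IsAttachedCell Y Φ) {j : ℕ} (hj : j ≠ k) :
    IsZero (relativeSingularHomology R M ↥(Y ∪ range Φ) (Subtype.val ⁻¹' Y) j) :=
  (h.isZero_relativeSingularHomology_range R M hj).of_iso (h.relativeSingularHomologyIso R M j).symm

end IsAttachedCell

end Literature.AlgebraicTopology.SingularHomology
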